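import Summits.CriticalPhenomena.PercolationContinuityZ3.Theorems.SahiMasterFamilyFCrossInductionAB

/-!
# The `F`-inequality: the LOCAL-CONCAVITY form of the cross step and the GOOD-COORDINATE reduction

Unit `prim-master-conj` (crux anchor stmt-CriticalPhenomena-4575, helper work), gen 22; memo
`run/shared/lean/prim/prim-l12/prim-master-conj/POINTWISE.md` §23.  Companion of prim-bnk-2's `…FCrossInduction` (∃-form induction skeleton).

`F(A,B;G) := (1 + μG)·μ(A∩B∩G) − μG·μ(A∩B) − μ(A∩G)·μ(B∩G)` is quadratic in each coordinate probability `t = p_e`; with the sections `X^b = X^{e←b}`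
(measures of sections are `p_e`-free) the EXACT form is
  `F = (1−t)·F(A⁰,B⁰;G⁰) + t·F(A¹,B¹;G¹) + t(1−t)·D_e`,   `D_e = Δa·Δb + Δg·Δm = −½·∂²F/∂p_e²`,
  `Δa = μ(A¹G¹) − μ(A⁰G⁰)`, `Δb = μ(B¹G¹) − μ(B⁰G⁰)`, `Δg = μG¹ − μG⁰`, `Δm = μ(A¹B¹∖G¹) − μ(A⁰B⁰∖G⁰)`
(equivalently: bnk-2's cross coefficient is `X_e = F⁰ + F¹ + D_e`, their "organising identity", here a kernel `ring` fact: `cross_eq_fZero_add_fOne_add_dLoc`,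
`fIneq_eq_chord_add_dLoc`).  Hence (`fIneq_ge_chord_of_dLoc_nonneg`) **`D_e ≥ 0 ⟹ F ≥ (1−p_e)F⁰ + p_eF¹`** (F lies above its chord along `e`), and
**THE GOOD-COORDINATE REDUCTION** (`fIneq_nonneg_of_goodCoordinate`): if every triple of increasing events with an essential coordinate has an ESSENTIAL
coordinate `e` (of `A`, `B` or `G`) with `D_e ≥ 0` — "`F` is concave along some essential coordinate direction at every point" — then `F(A,B;G) ≥ 0` for
ALL increasing `A, B, G` (plug into `SahiFInduction.F_nonneg_of_exists_cross_step`).  `D_e` involves NO induction hypothesis: it is a statement about one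
triple and its six sections.  EVIDENCE for the hypothesis (gen 22, exact/float census, memo §23): all triples on `{0,1}^3` (12 parameter vectors) and ALL
`2.4·10⁶` triples on `{0,1}^4` at each of 8 parameter vectors have a good coordinate (0 exceptions; adversarial search k ≤ 7 running) — while every AVERAGED
form (`Σ_e D_e ≥ 0`, `Σ_e p_eq_eD_e ≥ 0`) is false.  HONEST FRAMING: identity + conditional reduction; the good-coordinate hypothesis is a CONJECTURE;
`F ≥ 0` remains OPEN. [this work]
-/

noncomputable section

open scoped Classical

namespace Summit.CriticalPhenomena.PercolationContinuityZ3.Theorems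

open Finset Function
open Literature.Combinatorics.Sahi2008
open Literature.Probability.Percolation.DecisionTree (ind)

namespace Pointwise

variable {ι : Type} [Fintype ι]

local notation3 (prettyPrint := false) "μ⟦" p ", " X "⟧" => ex (bernoulliWeight p) (ind X)

/-- **`X_e = F⁰ + F¹ + D_e`**: prim-bnk-2's cross coefficient is the sum of the two section instances of `F` and the "local concavity"
`D_e = Δa·Δb + Δg·Δm` (`ring`). [this work] -/
theorem cross_eq_fZero_add_fOne_add_dLoc (p : ι → unitInterval) (e : ι) (A B G : Set (Set ι)) :
    μ⟦p, secAt e true A ∩ secAt e true B ∩ secAt e true G⟧ + μ⟦p, secAt e false A ∩ secAt e false B ∩ secAt e false G⟧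
        + μ⟦p, secAt e true G⟧ * μ⟦p, secAt e false A ∩ secAt e false B ∩ secAt e false G⟧
        + μ⟦p, secAt e false G⟧ * μ⟦p, secAt e true A ∩ secAt e true B ∩ secAt e true G⟧
        - μ⟦p, secAt e true G⟧ * μ⟦p, secAt e false A ∩ secAt e false B⟧
        - μ⟦p, secAt e false G⟧ * μ⟦p, secAt e true A ∩ secAt e true B⟧
        - μ⟦p, secAt e true A ∩ secAt e true G⟧ * μ⟦p, secAt e false B ∩ secAt e false G⟧
        - μ⟦p, secAt e false A ∩ secAt e false G⟧ * μ⟦p, secAt e true B ∩ secAt e true G⟧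
      = ((1 + μ⟦p, secAt e false G⟧) * μ⟦p, secAt e false A ∩ secAt e false B ∩ secAt e false G⟧
          - μ⟦p, secAt e false G⟧ * μ⟦p, secAt e false A ∩ secAt e false B⟧
          - μ⟦p, secAt e false A ∩ secAt e false G⟧ * μ⟦p, secAt e false B ∩ secAt e false G⟧)
        + ((1 + μ⟦p, secAt e true G⟧) * μ⟦p, secAt e true A ∩ secAt e true B ∩ secAt e true G⟧
          - μ⟦p, secAt e true G⟧ * μ⟦p, secAt e true A ∩ secAt e true B⟧
          - μ⟦p, secAt e true A ∩ secAt e true G⟧ * μ⟦p, secAt e true B ∩ secAt e true G⟧)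
        + ((μ⟦p, secAt e true A ∩ secAt e true G⟧ - μ⟦p, secAt e false A ∩ secAt e false G⟧)
            * (μ⟦p, secAt e true B ∩ secAt e true G⟧ - μ⟦p, secAt e false B ∩ secAt e false G⟧)
          + (μ⟦p, secAt e true G⟧ - μ⟦p, secAt e false G⟧)
            * ((μ⟦p, secAt e true A ∩ secAt e true B⟧ - μ⟦p, secAt e true A ∩ secAt e true B ∩ secAt e true G⟧)
              - (μ⟦p, secAt e false A ∩ secAt e false B⟧ - μ⟦p, secAt e false A ∩ secAt e false B ∩ secAt e false G⟧))) := by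
  ring

/-- **The exact chord form `F = (1−p_e)·F⁰ + p_e·F¹ + p_e(1−p_e)·D_e`** (from `SahiFInduction.F_bernstein_secAt` and the previous identity). [this work] -/
theorem fIneq_eq_chord_add_dLoc (p : ι → unitInterval) (e : ι) (A B G : Set (Set ι)) :
    (1 + μ⟦p, G⟧) * μ⟦p, A ∩ B ∩ G⟧ - μ⟦p, G⟧ * μ⟦p, A ∩ B⟧ - μ⟦p, A ∩ G⟧ * μ⟦p, B ∩ G⟧
      = (1 - (p e : ℝ)) * ((1 + μ⟦p, secAt e false G⟧) * μ⟦p, secAt e false A ∩ secAt e false B ∩ secAt e false G⟧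
          - μ⟦p, secAt e false G⟧ * μ⟦p, secAt e false A ∩ secAt e false B⟧
          - μ⟦p, secAt e false A ∩ secAt e false G⟧ * μ⟦p, secAt e false B ∩ secAt e false G⟧)
        + (p e : ℝ) * ((1 + μ⟦p, secAt e true G⟧) * μ⟦p, secAt e true A ∩ secAt e true B ∩ secAt e true G⟧
          - μ⟦p, secAt e true G⟧ * μ⟦p, secAt e true A ∩ secAt e true B⟧
          - μ⟦p, secAt e true A ∩ secAt e true G⟧ * μ⟦p, secAt e true B ∩ secAt e true G⟧)
        + (p e : ℝ) * (1 - (p e : ℝ)) *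
          ((μ⟦p, secAt e true A ∩ secAt e true G⟧ - μ⟦p, secAt e false A ∩ secAt e false G⟧)
              * (μ⟦p, secAt e true B ∩ secAt e true G⟧ - μ⟦p, secAt e false B ∩ secAt e false G⟧)
            + (μ⟦p, secAt e true G⟧ - μ⟦p, secAt e false G⟧)
              * ((μ⟦p, secAt e true A ∩ secAt e true B⟧ - μ⟦p, secAt e true A ∩ secAt e true B ∩ secAt e true G⟧)
                - (μ⟦p, secAt e false A ∩ secAt e false B⟧ - μ⟦p, secAt e false A ∩ secAt e false B ∩ secAt e false G⟧))) := by
  rw [SahiFInduction.F_bernstein_secAt p e A B G]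
  ring

/-- **Local concavity along `e` puts `F` above its chord**: `D_e ≥ 0 ⟹ F ≥ (1−p_e)·F(A⁰,B⁰;G⁰) + p_e·F(A¹,B¹;G¹)`. [this work] -/
theorem fIneq_ge_chord_of_dLoc_nonneg (p : ι → unitInterval) (e : ι) (A B G : Set (Set ι))
    (hD : 0 ≤ (μ⟦p, secAt e true A ∩ secAt e true G⟧ - μ⟦p, secAt e false A ∩ secAt e false G⟧)
              * (μ⟦p, secAt e true B ∩ secAt e true G⟧ - μ⟦p, secAt e false B ∩ secAt e false G⟧)
            + (μ⟦p, secAt e true G⟧ - μ⟦p, secAt e false G⟧)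
              * ((μ⟦p, secAt e true A ∩ secAt e true B⟧ - μ⟦p, secAt e true A ∩ secAt e true B ∩ secAt e true G⟧)
                - (μ⟦p, secAt e false A ∩ secAt e false B⟧ - μ⟦p, secAt e false A ∩ secAt e false B ∩ secAt e false G⟧))) :
    (1 - (p e : ℝ)) * ((1 + μ⟦p, secAt e false G⟧) * μ⟦p, secAt e false A ∩ secAt e false B ∩ secAt e false G⟧
          - μ⟦p, secAt e false G⟧ * μ⟦p, secAt e false A ∩ secAt e false B⟧
          - μ⟦p, secAt e false A ∩ secAt e false G⟧ * μ⟦p, secAt e false B ∩ secAt e false G⟧)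
        + (p e : ℝ) * ((1 + μ⟦p, secAt e true G⟧) * μ⟦p, secAt e true A ∩ secAt e true B ∩ secAt e true G⟧
          - μ⟦p, secAt e true G⟧ * μ⟦p, secAt e true A ∩ secAt e true B⟧
          - μ⟦p, secAt e true A ∩ secAt e true G⟧ * μ⟦p, secAt e true B ∩ secAt e true G⟧)
      ≤ (1 + μ⟦p, G⟧) * μ⟦p, A ∩ B ∩ G⟧ - μ⟦p, G⟧ * μ⟦p, A ∩ B⟧ - μ⟦p, A ∩ G⟧ * μ⟦p, B ∩ G⟧ := by
  rw [fIneq_eq_chord_add_dLoc p e A B G]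
  have ht0 : 0 ≤ (p e : ℝ) := (p e).2.1
  have ht1 : 0 ≤ 1 - (p e : ℝ) := sub_nonneg.2 (p e).2.2
  nlinarith [mul_nonneg (mul_nonneg ht0 ht1) hD]

/-- **THE GOOD-COORDINATE REDUCTION.**  Suppose that every triple of increasing events `A, B, G` with some essential coordinate has an essential
coordinate `e` (of `A`, `B` or `G`) along which `F` is locally concave, `D_e ≥ 0`.  Then `F(A,B;G) ≥ 0` for all increasing `A, B, G`.
(bnk-2's ∃-form skeleton: `X_e = F⁰ + F¹ + D_e ≥ 0` by the induction hypothesis on the sections.) [this work] -/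
theorem fIneq_nonneg_of_goodCoordinate (p : ι → unitInterval)
    (hGC : ∀ (A B G : Set (Set ι)), IsUpperSet A → IsUpperSet B → IsUpperSet G →
      0 < (esupp A).card + (esupp B).card + (esupp G).card →
      ∃ e, (e ∈ esupp A ∨ e ∈ esupp B ∨ e ∈ esupp G) ∧
        0 ≤ (μ⟦p, secAt e true A ∩ secAt e true G⟧ - μ⟦p, secAt e false A ∩ secAt e false G⟧)
              * (μ⟦p, secAt e true B ∩ secAt e true G⟧ - μ⟦p, secAt e false B ∩ secAt e false G⟧)
            + (μ⟦p, secAt e true G⟧ - μ⟦p, secAt e false G⟧)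
              * ((μ⟦p, secAt e true A ∩ secAt e true B⟧ - μ⟦p, secAt e true A ∩ secAt e true B ∩ secAt e true G⟧)
                - (μ⟦p, secAt e false A ∩ secAt e false B⟧ - μ⟦p, secAt e false A ∩ secAt e false B ∩ secAt e false G⟧))) :
    ∀ (A B G : Set (Set ι)), IsUpperSet A → IsUpperSet B → IsUpperSet G →
      0 ≤ (1 + μ⟦p, G⟧) * μ⟦p, A ∩ B ∩ G⟧ - μ⟦p, G⟧ * μ⟦p, A ∩ B⟧ - μ⟦p, A ∩ G⟧ * μ⟦p, B ∩ G⟧ := by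
  refine SahiFInduction.F_nonneg_of_exists_cross_step p fun A B G hA hB hG hpos ih => ?_
  obtain ⟨e, he, hD⟩ := hGC A B G hA hB hG hpos
  refine ⟨e, he, ?_⟩
  -- the two section instances have smaller total essential support, so the induction hypothesis applies
  have hlt : ∀ b : Bool, (esupp (secAt e b A)).card + (esupp (secAt e b B)).card + (esupp (secAt e b G)).card
      < (esupp A).card + (esupp B).card + (esupp G).card := by
    intro b
    have lA := SahiClassTCube.card_esupp_secAt_le hA e b
    have lB := SahiClassTCube.card_esupp_secAt_le hB e b
    have lG := SahiClassTCube.card_esupp_secAt_le hG e b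
    rcases he with h | h | h
    · have := SahiClassTCube.card_esupp_secAt_lt hA h b; omega
    · have := SahiClassTCube.card_esupp_secAt_lt hB h b; omega
    · have := SahiClassTCube.card_esupp_secAt_lt hG h b; omega
  have ihsec : ∀ b : Bool, 0 ≤ (1 + μ⟦p, secAt e b G⟧) * μ⟦p, secAt e b A ∩ secAt e b B ∩ secAt e b G⟧
      - μ⟦p, secAt e b G⟧ * μ⟦p, secAt e b A ∩ secAt e b B⟧ - μ⟦p, secAt e b A ∩ secAt e b G⟧ * μ⟦p, secAt e b B ∩ secAt e b G⟧ :=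
    fun b => ih _ _ _ (isUpperSet_secAt e b hA) (isUpperSet_secAt e b hB) (isUpperSet_secAt e b hG) (hlt b)
  rw [cross_eq_fZero_add_fOne_add_dLoc p e A B G]
  have h0 := ihsec false
  have h1 := ihsec true
  linarith

/-- **The diagonal case `B = A` of the local concavity**: `D_e = I_e(AG)² + I_e(G)·(I_e(A) − I_e(AG))` in section measures
(`I_e(U) = μ(U¹) − μ(U⁰)`).  CORRECTION TO THE FILE HEADER (same generation, later the same day): the good-coordinate HYPOTHESIS of
`fIneq_nonneg_of_goodCoordinate` is FALSE in general — for `A = B = Tribes(9,301)` (OR of 301 disjoint ANDs of size 9) and `G =` majority of the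
same `2709` coordinates at `p ≡ ½`, this diagonal `D_e` equals `−2.537868·10⁻⁵ < 0` for EVERY coordinate (exact integer computation,
memo §23.A′; mechanism: `D_e ≈ −I_e(G)²/4` whenever `A = B` is balanced on the annulus of `G` with `max_e I_e(A) ≲ 0.24·I_e(G)`), while it
holds for all triples on `≤ 4` coordinates (exhaustive census) and in every small search.  So the reduction above is a correct but, for
general supports, vacuous route; the induction must borrow from `F⁰ + F¹` (prim-bnk-2's multipliers), i.e. the live hypothesis is
`X_e = F⁰ + F¹ + D_e ≥ 0` (CROSS), not `D_e ≥ 0`. [this work] -/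
theorem dLoc_eq_of_second_eq_first (p : ι → unitInterval) (e : ι) (A G : Set (Set ι)) :
    (μ⟦p, secAt e true A ∩ secAt e true G⟧ - μ⟦p, secAt e false A ∩ secAt e false G⟧)
          * (μ⟦p, secAt e true A ∩ secAt e true G⟧ - μ⟦p, secAt e false A ∩ secAt e false G⟧)
        + (μ⟦p, secAt e true G⟧ - μ⟦p, secAt e false G⟧)
          * ((μ⟦p, secAt e true A ∩ secAt e true A⟧ - μ⟦p, secAt e true A ∩ secAt e true A ∩ secAt e true G⟧)
            - (μ⟦p, secAt e false A ∩ secAt e false A⟧ - μ⟦p, secAt e false A ∩ secAt e false A ∩ secAt e false G⟧))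
      = (μ⟦p, secAt e true A ∩ secAt e true G⟧ - μ⟦p, secAt e false A ∩ secAt e false G⟧) ^ 2
        + (μ⟦p, secAt e true G⟧ - μ⟦p, secAt e false G⟧)
          * ((μ⟦p, secAt e true A⟧ - μ⟦p, secAt e false A⟧)
            - (μ⟦p, secAt e true A ∩ secAt e true G⟧ - μ⟦p, secAt e false A ∩ secAt e false G⟧)) := by
  simp only [Set.inter_self]
  ring

end Pointwise

end Summit.CriticalPhenomena.PercolationContinuityZ3.Theorems
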